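import Mathlib.Algebra.Module.PID
import Mathlib.Algebra.Polynomial.Module.AEval
import Mathlib.FieldTheory.Galois.Basic
import Mathlib.LinearAlgebra.Finsupp.VectorSpace
import Mathlib.LinearAlgebra.Matrix.Charpoly.Coeff
import Mathlib.LinearAlgebra.Matrix.ToLinearEquiv
import Mathlib.RingTheory.AdjoinRoot
import Mathlib.RingTheory.Artinian.Module
import Mathlib.RingTheory.Polynomial.Basic
import Literature.NumberTheory.Automorphic.ArthurClozelNormMap
import HarnessLib

/-!
# Norms are conjugate to rational elements (Arthur–Clozel, Ch. 1, Lemma 1.1 (i), existence)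

Continuation of `Literature.NumberTheory.Automorphic.ArthurClozelNormMap` (which proves the
uniqueness clause of Lemma 1.1 (i) and the well-definedness behind (ii)) and
`Literature.NumberTheory.Automorphic.ArthurClozelNormMapInjective` (Lemma 1.1 (ii)).

Arthur–Clozel, *Simple algebras, base change, and the advanced theory of the trace formula*,
Ann. of Math. Stud. 120 (1989), Ch. 1, §1, **Lemma 1.1 (i), existence clause**: for a cyclic
extension `E / F` with `Gal(E/F) = ⟨σ⟩` of order `ℓ` and `x ∈ GL_n(E)`, *the norm
`N x = x x^σ ⋯ x^{σ^{ℓ-1}}` is conjugate in `GL_n(E)` to an element `y` of `GL_n(F)`*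
(`exists_isConj_map_algebraMap_normMap`). We prove it for `ℓ` **prime** (the case of the tree's
base-change files and of Arthur–Clozel's Theorems 3.4.2, 3.5.1, 3.6.2; Arthur–Clozel state
Lemma 1.1 for a cyclic extension of any degree).

## The proof

Arthur–Clozel (following Langlands, *Base change for `GL(2)`*, §4) read the statement off the
elementary divisors `p₁ | p₂ | ⋯ | p_r` of `N x`: since `(N x)^σ = x⁻¹ (N x) x`, they are
`σ`-invariant, hence lie in `F[X]`, "so the conjugacy class of `N x` is defined over `F`". The
uniqueness of the invariant factors (rational canonical form) is not in Mathlib; we replace it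
by the following argument, which only uses the *existence* half of the structure theorem for
finitely generated torsion modules over `E[X]` (`Module.torsion_by_prime_power_decomposition`).

Put `u = N x` and let `φ = x ∘ σ` act on `W = Eⁿ` (`φ v = x · σ(v)`): `φ` is a `σ`-semilinear
bijection, `φ^ℓ = u` and `φ u = u φ`, so `φ g(u) = g^σ(u) φ` for every `g ∈ E[X]`. Call an
endomorphism `T` of a finite-dimensional `E`-space *rational over `F`* if some finite spanning,
linearly independent set has an `F`-span stable under `T` (i.e. the matrix of `T` in that basis
has entries in `F`). We show by induction on `dim W` that any `T` admitting such a `φ`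
(`σ`-semilinear bijection with `φ T = T φ`, `φ^ℓ = T`) is rational over `F`. Let `q` be a monic
irreducible factor of the minimal polynomial of `T`.
* If `q^σ = q`, then `q ∈ F[X]` and, by Fitting's lemma, `W = ker q(T)^k ⊕ im q(T)^k` with both
  summands `T`- and `φ`-stable; `ker q(T)^k ≅ ⊕ᵢ E[X]/(q^{kᵢ})` (structure theorem, existence)
  and multiplication by `X` on `E[X]/(g)`, `g ∈ F[X]` monic, is rational in the power basis
  (companion matrix); the image is rational by induction (its dimension dropped because
  `ker q(T) ≠ 0`, `q` dividing the minimal polynomial).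
* If `q^σ ≠ q`, the `ℓ` conjugates `qⱼ = q^{σ^j}` are pairwise distinct (`ℓ` is prime), and with
  `G = ∏ⱼ qⱼ` (a `σ`-invariant polynomial) Fitting's lemma gives `W = ker G(T)^k ⊕ im G(T)^k`,
  again `T`- and `φ`-stable, the image rational by induction, and
  `ker G(T)^k = ⊕ⱼ Mⱼ`, `Mⱼ = ker qⱼ(T)^k = φ^j(M₀)`. If `b` is an `E`-basis of `M₀` with
  `T bᵢ = ∑ U_{i'i} b_{i'}` and `ε₁, …, ε_ℓ` an `F`-basis of `E`, the vectors
  `β_{k,i} = ∑ⱼ φ^j(ε_k bᵢ) = ∑ⱼ σ^j(ε_k) φ^j(bᵢ)` form an `E`-basis of `ker G(T)^k` — the matrix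
  `(σ^j(ε_k))_{j,k}` is invertible by Dedekind's independence of automorphisms — and
  `T β_{k,i} = ∑ⱼ φ^j(ε_k U_{i'i} b_{i'}) = ∑_{k',i'} Y_{(k',i'),(k,i)} β_{k',i'}` where
  `Y ∈ F` are the coordinates of `ε_k U_{i'i}` in the basis `ε`: rational.
Finally a rational `u` is conjugate, by the change-of-basis matrix, to the matrix `y ∈ GL_n(F)`
of `u` in the good basis.

## Main statements

* `ArthurClozel.isRationalEnd_of_semilinear`: the abstract descent statement above.
* `ArthurClozel.exists_isConj_map_algebraMap_normMap`: Lemma 1.1 (i), existence, for `E / F`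
  Galois of prime degree and `σ ≠ 1`.

## References
* J. Arthur, L. Clozel, *Simple algebras, base change, and the advanced theory of the trace
  formula*, Ann. of Math. Stud. 120 (1989), Ch. 1, §1, Lemma 1.1 (i).
* R. P. Langlands, *Base change for `GL(2)`*, Ann. of Math. Stud. 96 (1980), §4.
-/

open Polynomial Module

namespace Literature.NumberTheory.Automorphic

namespace ArthurClozel

variable {F E : Type*} [Field F] [Field E] [Algebra F E]

/-! ### Rational endomorphisms -/

section Rational

variable {W : Type*} [AddCommGroup W] [Module E W] [Module F W] [IsScalarTower F E W]

variable (F) in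
/-- An `E`-linear endomorphism `T` of `W` is **rational over `F`** (with respect to
`algebraMap F E`) if `W` has a finite, linearly independent, spanning subset whose `F`-span is
stable under `T` — i.e. a finite `E`-basis in which the matrix of `T` has all its entries in `F`.
[folklore] -/
def IsRationalEnd (T : W →ₗ[E] W) : Prop :=
  ∃ S : Set W, S.Finite ∧ LinearIndepOn E id S ∧ Submodule.span E S = ⊤ ∧
    ∀ s ∈ S, T s ∈ Submodule.span F S

omit [Algebra F E] [IsScalarTower F E W] in
/-- A finite linearly independent spanning family with `T`-stable `F`-span witnesses
rationality. [folklore] -/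
theorem IsRationalEnd.of_family {ι : Type*} [Finite ι] {T : W →ₗ[E] W} (v : ι → W)
    (hli : LinearIndependent E v) (hsp : Submodule.span E (Set.range v) = ⊤)
    (hv : ∀ i, T (v i) ∈ Submodule.span F (Set.range v)) : IsRationalEnd F T :=
  ⟨Set.range v, Set.finite_range v, hli.linearIndepOn_id, hsp, by
    rintro _ ⟨i, rfl⟩
    exact hv i⟩

omit [Algebra F E] [IsScalarTower F E W] in
/-- A finite basis with `T`-stable `F`-span witnesses rationality. [folklore] -/
theorem IsRationalEnd.of_basis {ι : Type*} [Finite ι] {T : W →ₗ[E] W} (b : Basis ι E W)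
    (hb : ∀ i, T (b i) ∈ Submodule.span F (Set.range b)) : IsRationalEnd F T :=
  .of_family b b.linearIndependent b.span_eq hb

omit [Algebra F E] [IsScalarTower F E W] in
/-- The zero space: every endomorphism is rational. [folklore] -/
theorem IsRationalEnd.of_subsingleton [Subsingleton W] (T : W →ₗ[E] W) : IsRationalEnd F T :=
  ⟨∅, Set.finite_empty, linearIndepOn_empty E id, by
    simp only [Submodule.span_empty]
    exact (Submodule.eq_bot_of_subsingleton).symm, fun s hs => hs.elim⟩

/-- Rationality is transported along `E`-linear isomorphisms intertwining the endomorphisms.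
[folklore] -/
theorem IsRationalEnd.of_equiv {W' : Type*} [AddCommGroup W'] [Module E W'] [Module F W']
    [IsScalarTower F E W'] {T : W →ₗ[E] W} {T' : W' →ₗ[E] W'} (e : W ≃ₗ[E] W')
    (he : ∀ w, e (T w) = T' (e w)) (h : IsRationalEnd F T) : IsRationalEnd F T' := by
  obtain ⟨S, hSf, hSi, hSs, hST⟩ := h
  refine ⟨e '' S, hSf.image _, ?_, ?_, ?_⟩
  · have h1 : LinearIndependent E ((e : W →ₗ[E] W') ∘ fun s : S => (s : W)) :=
      hSi.map' (e : W →ₗ[E] W') e.ker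
    have h2 := h1.linearIndepOn_id
    rwa [Set.range_comp, Subtype.range_coe_subtype, Set.setOf_mem_eq] at h2
  · have hc : ⇑e '' S = (e : W →ₗ[E] W') '' S := rfl
    rw [hc, Submodule.span_image, hSs, Submodule.map_top, LinearEquiv.range]
  · rintro _ ⟨s, hs, rfl⟩
    rw [← he]
    have := Submodule.apply_mem_span_image_of_mem_span ((e : W →ₗ[E] W').restrictScalars F)
      (hST s hs)
    exact this

/-- Rationality of an endomorphism follows from rationality of its restrictions to two
complementary stable subspaces. [folklore] -/
theorem IsRationalEnd.of_isCompl {T : W →ₗ[E] W} {p q : Submodule E W} (hpq : IsCompl p q)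
    (hp : ∀ v ∈ p, T v ∈ p) (hq : ∀ v ∈ q, T v ∈ q)
    (hTp : IsRationalEnd F (T.restrict hp)) (hTq : IsRationalEnd F (T.restrict hq)) :
    IsRationalEnd F T := by
  obtain ⟨S₁, hS₁f, hS₁i, hS₁s, hS₁T⟩ := hTp
  obtain ⟨S₂, hS₂f, hS₂i, hS₂s, hS₂T⟩ := hTq
  -- the images of `S₁`, `S₂` in `W`
  have hr₁ : Set.range ((p.subtype : p →ₗ[E] W) ∘ fun s : S₁ => (s : p)) = p.subtype '' S₁ := by
    rw [Set.range_comp, Subtype.range_coe_subtype, Set.setOf_mem_eq]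
  have hr₂ : Set.range ((q.subtype : q →ₗ[E] W) ∘ fun s : S₂ => (s : q)) = q.subtype '' S₂ := by
    rw [Set.range_comp, Subtype.range_coe_subtype, Set.setOf_mem_eq]
  have hsp₁ : Submodule.span E (p.subtype '' S₁) = p := by
    rw [Submodule.span_image, hS₁s, Submodule.map_top, Submodule.range_subtype]
  have hsp₂ : Submodule.span E (q.subtype '' S₂) = q := by
    rw [Submodule.span_image, hS₂s, Submodule.map_top, Submodule.range_subtype]
  refine ⟨p.subtype '' S₁ ∪ q.subtype '' S₂, (hS₁f.image _).union (hS₂f.image _), ?_, ?_, ?_⟩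
  · apply LinearIndepOn.id_union
    · have h1 : LinearIndependent E ((p.subtype : p →ₗ[E] W) ∘ fun s : S₁ => (s : p)) :=
        hS₁i.map' _ p.ker_subtype
      simpa only [hr₁] using h1.linearIndepOn_id
    · have h2 : LinearIndependent E ((q.subtype : q →ₗ[E] W) ∘ fun s : S₂ => (s : q)) :=
        hS₂i.map' _ q.ker_subtype
      simpa only [hr₂] using h2.linearIndepOn_id
    · rw [hsp₁, hsp₂]
      exact hpq.disjoint
  · rw [Submodule.span_union, hsp₁, hsp₂]
    exact hpq.sup_eq_top
  · rintro s (⟨s₁, hs₁, rfl⟩ | ⟨s₂, hs₂, rfl⟩)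
    · have h1 : T (p.subtype s₁) = p.subtype (T.restrict hp s₁) := rfl
      rw [h1]
      have := Submodule.apply_mem_span_image_of_mem_span
        ((p.subtype : p →ₗ[E] W).restrictScalars F) (hS₁T s₁ hs₁)
      exact Submodule.span_mono Set.subset_union_left this
    · have h2 : T (q.subtype s₂) = q.subtype (T.restrict hq s₂) := rfl
      rw [h2]
      have := Submodule.apply_mem_span_image_of_mem_span
        ((q.subtype : q →ₗ[E] W).restrictScalars F) (hS₂T s₂ hs₂)
      exact Submodule.span_mono Set.subset_union_right this

/-- Rationality of the restriction of `T` to a stable subspace `p`, from a finite linearly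
independent subset of `W` spanning `p` with `T`-stable `F`-span. [folklore] -/
theorem IsRationalEnd.restrict_of_span_eq {T : W →ₗ[E] W} {p : Submodule E W}
    (hp : ∀ v ∈ p, T v ∈ p) (S : Set W) (hSf : S.Finite) (hSi : LinearIndepOn E id S)
    (hSp : Submodule.span E S = p) (hST : ∀ s ∈ S, T s ∈ Submodule.span F S) :
    IsRationalEnd F (T.restrict hp) := by
  have hSsub : S ⊆ p := fun s hs => hSp ▸ Submodule.subset_span hs
  set S' : Set p := ((↑) : p → W) ⁻¹' S with hS'
  have himg : ((↑) : p → W) '' S' = S := by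
    rw [hS', Set.image_preimage_eq_inter_range, Subtype.range_coe_subtype]
    exact Set.inter_eq_left.2 fun s hs => hSsub hs
  refine ⟨S', hSf.preimage Subtype.coe_injective.injOn, ?_, ?_, ?_⟩
  · -- linear independence
    have h1 : LinearIndependent E ((p.subtype : p →ₗ[E] W) ∘ fun s : S' => (s : p)) := by
      have : ((p.subtype : p →ₗ[E] W) ∘ fun s : S' => (s : p)) =
          (fun s : S => (s : W)) ∘ fun s : S' => (⟨(s : p), s.2⟩ : S) := rfl
      rw [this]
      refine hSi.comp _ ?_
      intro a b hab
      apply Subtype.ext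
      apply Subtype.ext
      exact congrArg (fun z : S => (z : W)) hab
    exact h1.of_comp _
  · apply Submodule.map_injective_of_injective p.injective_subtype
    rw [Submodule.map_subtype_top, ← Submodule.span_image]
    change Submodule.span E (((↑) : p → W) '' S') = p
    rw [himg, hSp]
  · intro s hs
    have hTs : T (s : W) ∈ Submodule.span F S := hST _ hs
    have hc : ((↑) : p → W) '' S' = ((p.subtype : p →ₗ[E] W).restrictScalars F) '' S' := rfl
    rw [← himg, hc, Submodule.span_image] at hTs
    obtain ⟨y, hy, hy'⟩ := Submodule.mem_map.1 hTs
    have : y = T.restrict hp s := by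
      apply Subtype.ext
      simpa [LinearMap.restrict_apply] using hy'
    exact this ▸ hy

end Rational

/-! ### `σ`-semilinear maps commuting with an endomorphism -/

section Semilinear

variable {W : Type*} [AddCommGroup W] [Module E W]
variable {σ : E ≃ₐ[F] E} {T : W →ₗ[E] W}

/-- The `j`-th iterate of a `σ`-semilinear map, as a `σ^j`-semilinear map. [folklore] -/
def iterateSL (φ : W →ₛₗ[(σ : E →+* E)] W) (j : ℕ) :
    W →ₛₗ[((σ ^ j : E ≃ₐ[F] E) : E →+* E)] W where
  toFun := (⇑φ)^[j]
  map_add' v w := by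
    induction j generalizing v w with
    | zero => rfl
    | succ j ih => rw [Function.iterate_succ_apply, Function.iterate_succ_apply,
        Function.iterate_succ_apply, map_add, ih]
  map_smul' c w := by
    induction j generalizing c w with
    | zero => simp
    | succ j ih =>
      rw [Function.iterate_succ_apply, Function.iterate_succ_apply, LinearMap.map_smulₛₗ, ih]
      simp only [RingHom.coe_coe, pow_succ, AlgEquiv.mul_apply]

/-- `iterateSL φ j` is `φ^j` as a function. [folklore] -/
@[simp]
theorem iterateSL_apply (φ : W →ₛₗ[(σ : E →+* E)] W) (j : ℕ) (w : W) :
    iterateSL φ j w = (⇑φ)^[j] w := rfl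

variable {φ : W →ₛₗ[(σ : E →+* E)] W}

/-- A map commuting with `T` commutes with the powers of `T`. [folklore] -/
theorem semilinear_apply_pow (hφT : ∀ w, φ (T w) = T (φ w)) (k : ℕ) (w : W) :
    φ ((T ^ k) w) = (T ^ k) (φ w) := by
  induction k generalizing w with
  | zero => simp
  | succ k ih => rw [pow_succ, Module.End.mul_apply, ih, hφT, Module.End.mul_apply]

/-- **`φ g(T) = g^σ(T) φ`** for a `σ`-semilinear `φ` commuting with `T`. [folklore] -/
theorem semilinear_apply_aeval (hφT : ∀ w, φ (T w) = T (φ w)) (g : E[X]) (w : W) :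
    φ (aeval T g w) = aeval T (g.map (σ : E →+* E)) (φ w) := by
  induction g using Polynomial.induction_on' generalizing w with
  | add p q hp hq => simp [hp, hq, Polynomial.map_add]
  | monomial k c =>
    simp only [Polynomial.map_monomial, aeval_monomial, Module.End.mul_apply,
      Module.algebraMap_end_apply, LinearMap.map_smulₛₗ, semilinear_apply_pow hφT]

/-- The iterates of `φ` commute with `T`. [folklore] -/
theorem semilinear_iterate_comm (hφT : ∀ w, φ (T w) = T (φ w)) (j : ℕ) (w : W) :
    (⇑φ)^[j] (T w) = T ((⇑φ)^[j] w) := by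
  induction j generalizing w with
  | zero => rfl
  | succ j ih => rw [Function.iterate_succ_apply, Function.iterate_succ_apply, hφT, ih]

/-- `φ^j g(T) = g^{σ^j}(T) φ^j`. [folklore] -/
theorem semilinear_iterate_apply_aeval (hφT : ∀ w, φ (T w) = T (φ w)) (j : ℕ) (g : E[X])
    (w : W) :
    (⇑φ)^[j] (aeval T g w) = aeval T (g.map ((σ ^ j : E ≃ₐ[F] E) : E →+* E)) ((⇑φ)^[j] w) := by
  induction j generalizing g w with
  | zero =>
    have h1 : g.map ((1 : E ≃ₐ[F] E) : E →+* E) = g := by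
      ext n
      simp [Polynomial.coeff_map]
    simp only [Function.iterate_zero, id_eq, pow_zero, h1]
  | succ j ih =>
    rw [Function.iterate_succ_apply', ih, semilinear_apply_aeval hφT, Polynomial.map_map,
      Function.iterate_succ_apply']
    congr 2
    ext e
    simp [pow_succ', AlgEquiv.mul_apply]

/-- `φ^j` maps `ker g(T)` into `ker g^{σ^j}(T)`. [folklore] -/
theorem semilinear_iterate_mem_ker (hφT : ∀ w, φ (T w) = T (φ w)) {g : E[X]} {w : W}
    (hw : w ∈ LinearMap.ker (aeval T g)) (j : ℕ) :
    (⇑φ)^[j] w ∈ LinearMap.ker (aeval T (g.map ((σ ^ j : E ≃ₐ[F] E) : E →+* E))) := by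
  rw [LinearMap.mem_ker] at hw ⊢
  rw [← semilinear_iterate_apply_aeval hφT, hw]
  exact Function.iterate_fixed (map_zero φ) j

/-- `φ` maps `ker g(T)` into `ker g^σ(T)`. [folklore] -/
theorem semilinear_mem_ker (hφT : ∀ w, φ (T w) = T (φ w)) {g : E[X]} {w : W}
    (hw : w ∈ LinearMap.ker (aeval T g)) :
    φ w ∈ LinearMap.ker (aeval T (g.map (σ : E →+* E))) := by
  rw [LinearMap.mem_ker] at hw ⊢
  rw [← semilinear_apply_aeval hφT, hw, map_zero]

/-- `φ` maps `im g(T)` into `im g^σ(T)`. [folklore] -/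
theorem semilinear_mem_range (hφT : ∀ w, φ (T w) = T (φ w)) {g : E[X]} {w : W}
    (hw : w ∈ LinearMap.range (aeval T g)) :
    φ w ∈ LinearMap.range (aeval T (g.map (σ : E →+* E))) := by
  obtain ⟨v, rfl⟩ := LinearMap.mem_range.1 hw
  exact LinearMap.mem_range.2 ⟨φ v, (semilinear_apply_aeval hφT g v).symm⟩

/-- A `σ`-semilinear injection maps linearly independent families to linearly independent
families. [folklore] -/
theorem linearIndependent_comp_semilinear {ι : Type*} {τ : E ≃ₐ[F] E}
    (ψ : W →ₛₗ[(τ : E →+* E)] W) (hψ : Function.Injective ψ) {v : ι → W}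
    (hv : LinearIndependent E v) : LinearIndependent E (ψ ∘ v) := by
  rw [linearIndependent_iff'] at hv ⊢
  intro s c hc i hi
  have h0 : ψ (∑ j ∈ s, τ.symm (c j) • v j) = 0 := by
    rw [map_sum]
    simp only [LinearMap.map_smulₛₗ, RingHom.coe_coe, AlgEquiv.apply_symm_apply]
    exact hc
  rw [← map_zero ψ] at h0
  have h1 := hv s (fun j => τ.symm (c j)) (hψ h0) i hi
  simpa using congrArg τ h1

/-- `g(T)` commutes with `T`. [folklore] -/
theorem aeval_apply_comm (g : E[X]) (w : W) : aeval T g (T w) = T (aeval T g w) := by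
  have h : aeval T (g * X) = aeval T (X * g) := by rw [mul_comm]
  rw [map_mul, map_mul, aeval_X] at h
  exact congrArg (fun f : Module.End E W => f w) h

/-- `ker g(T)` is `T`-stable. [folklore] -/
theorem mem_ker_aeval_of_mem (g : E[X]) {w : W} (hw : w ∈ LinearMap.ker (aeval T g)) :
    T w ∈ LinearMap.ker (aeval T g) := by
  rw [LinearMap.mem_ker] at hw ⊢
  rw [aeval_apply_comm, hw, map_zero]

/-- `im g(T)` is `T`-stable. [folklore] -/
theorem mem_range_aeval_of_mem (g : E[X]) {w : W} (hw : w ∈ LinearMap.range (aeval T g)) :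
    T w ∈ LinearMap.range (aeval T g) := by
  obtain ⟨v, rfl⟩ := LinearMap.mem_range.1 hw
  exact LinearMap.mem_range.2 ⟨T v, aeval_apply_comm (T := T) g v⟩

end Semilinear

/-! ### Kernels of coprime polynomials in `T` -/

section Coprime

variable {W : Type*} [AddCommGroup W] [Module E W] {T : W →ₗ[E] W}

omit [Field F] [Algebra F E] in
/-- `ker g(T) ≤ ker h(T)` when `g ∣ h`. [folklore] -/
theorem ker_aeval_le_of_dvd {g h : E[X]} (hgh : g ∣ h) :
    LinearMap.ker (aeval T g) ≤ LinearMap.ker (aeval T h) := by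
  obtain ⟨r, rfl⟩ := hgh
  intro w hw
  rw [LinearMap.mem_ker] at hw ⊢
  rw [mul_comm, map_mul, Module.End.mul_apply, hw, map_zero]

omit [Field F] [Algebra F E] in
/-- **Kernels of pairwise coprime polynomials in `T` add up to the kernel of the product.**
[folklore] -/
theorem biSup_ker_aeval_eq_of_pairwise_isCoprime {ι : Type*} [DecidableEq ι] (g : ι → E[X])
    (s : Finset ι) (hcop : (s : Set ι).Pairwise fun i j => IsCoprime (g i) (g j)) :
    ⨆ i ∈ s, LinearMap.ker (aeval T (g i)) = LinearMap.ker (aeval T (∏ i ∈ s, g i)) := by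
  induction s using Finset.induction_on with
  | empty =>
    simp only [Finset.notMem_empty, not_false_eq_true, iSup_neg, iSup_bot, Finset.prod_empty,
      map_one]
    exact (LinearMap.ker_id).symm
  | insert a s ha ih =>
    rw [Finset.iSup_insert, Finset.prod_insert ha, ih fun i hi j hj hij =>
      hcop (Finset.mem_insert_of_mem hi) (Finset.mem_insert_of_mem hj) hij]
    apply Polynomial.sup_ker_aeval_eq_ker_aeval_mul_of_coprime
    exact IsCoprime.prod_right fun i hi => hcop (Finset.mem_insert_self a s)
      (Finset.mem_insert_of_mem hi) (fun h => ha (h ▸ hi))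

omit [Field F] [Algebra F E] in
/-- **Kernels of pairwise coprime polynomials in `T` are independent.** [folklore] -/
theorem iSupIndep_ker_aeval_of_pairwise_isCoprime {ι : Type*} [Fintype ι] (g : ι → E[X])
    (hcop : Pairwise fun i j => IsCoprime (g i) (g j)) :
    iSupIndep fun i => LinearMap.ker (aeval T (g i)) := by
  classical
  rw [iSupIndep_def]
  intro i
  have h1 : ⨆ (j) (_ : j ≠ i), LinearMap.ker (aeval T (g j)) =
      ⨆ j ∈ Finset.univ.erase i, LinearMap.ker (aeval T (g j)) := by
    simp [Finset.mem_erase]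
  rw [h1, biSup_ker_aeval_eq_of_pairwise_isCoprime g _ fun a _ b _ hab => hcop hab]
  apply Polynomial.disjoint_ker_aeval_of_isCoprime
  exact IsCoprime.prod_right fun j hj => hcop (Finset.ne_of_mem_erase hj).symm

omit [Field F] [Algebra F E] in
/-- Kernels of pairwise coprime polynomials in `T`, over a finite index type, add up to the
kernel of the product. [folklore] -/
theorem iSup_ker_aeval_eq_of_pairwise_isCoprime {ι : Type*} [Fintype ι] (g : ι → E[X])
    (hcop : Pairwise fun i j => IsCoprime (g i) (g j)) :
    ⨆ i, LinearMap.ker (aeval T (g i)) = LinearMap.ker (aeval T (∏ i, g i)) := by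
  classical
  rw [← biSup_ker_aeval_eq_of_pairwise_isCoprime g Finset.univ fun a _ b _ hab => hcop hab]
  simp

end Coprime

/-! ### The block `q^σ = q`: endomorphisms killed by a power of an `F`-rational irreducible -/

section FixedBlock

open scoped DirectSum

/-- The power basis `1, x, …, x^{d-1}` of the module quotient `E[X]/(g)`, `g ∈ E[X]` monic of
degree `d` (Mathlib's `AdjoinRoot.powerBasis'`, transported to the module quotient).
[folklore] -/
noncomputable def quotPowerBasis {g : E[X]} (hg : g.Monic) :
    Basis (Fin g.natDegree) E (E[X] ⧸ E[X] ∙ g) :=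
  (AdjoinRoot.powerBasis' hg).basis

omit [Field F] [Algebra F E] in
/-- The `t`-th vector of the power basis is the class of `X^t`. [folklore] -/
theorem quotPowerBasis_apply {g : E[X]} (hg : g.Monic) (t : Fin g.natDegree) :
    quotPowerBasis hg t = Submodule.Quotient.mk (X ^ (t : ℕ)) := by
  change (AdjoinRoot.powerBasis' hg).basis t = AdjoinRoot.mk g (X ^ (t : ℕ))
  rw [(AdjoinRoot.powerBasis' hg).basis_eq_pow, map_pow]
  rfl

/-- **The companion matrix is rational**: for a monic `g ∈ E[X]` with coefficients in `F`,
multiplication by `X` on `E[X]/(g)` maps the power basis `1, x, …, x^{d-1}` into its `F`-span.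
[folklore] -/
theorem X_smul_quotPowerBasis_mem_span {g : E[X]} (hg : g.Monic)
    (hcoef : ∀ n, g.coeff n ∈ Set.range (algebraMap F E)) (t : Fin g.natDegree) :
    (X : E[X]) • quotPowerBasis hg t ∈ Submodule.span F (Set.range (quotPowerBasis hg)) := by
  have hX : (X : E[X]) • quotPowerBasis hg t =
      (Submodule.Quotient.mk (X ^ ((t : ℕ) + 1)) : E[X] ⧸ E[X] ∙ g) := by
    rw [quotPowerBasis_apply, ← Submodule.Quotient.mk_smul, smul_eq_mul, ← pow_succ']
  rw [hX]
  by_cases ht : (t : ℕ) + 1 < g.natDegree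
  · exact Submodule.subset_span ⟨⟨_, ht⟩, quotPowerBasis_apply hg _⟩
  · -- `t + 1 = deg g`: `x^d = -∑_{i<d} g_i x^i` with `g_i ∈ F`
    have hD : (t : ℕ) + 1 = g.natDegree := by
      have := t.2
      omega
    set mk : E[X] →ₗ[E[X]] E[X] ⧸ E[X] ∙ g := (E[X] ∙ g).mkQ with hmk
    have h0 : mk (X ^ g.natDegree) +
        ∑ i ∈ Finset.range g.natDegree, g.coeff i • mk (X ^ i) = 0 := by
      have h := congrArg mk hg.as_sum
      have hg0 : mk g = 0 := by
        rw [hmk, Submodule.mkQ_apply, Submodule.Quotient.mk_eq_zero]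
        exact Submodule.mem_span_singleton_self g
      rw [hg0, map_add, map_sum] at h
      simp only [Polynomial.C_mul', LinearMap.map_smul_of_tower] at h
      exact h.symm
    have hmkX : ∀ i, mk (X ^ i) = Submodule.Quotient.mk (X ^ i) := fun i => rfl
    rw [hD, ← hmkX, eq_neg_of_add_eq_zero_left h0]
    refine Submodule.neg_mem _ (Submodule.sum_mem _ fun i hi => ?_)
    obtain ⟨c, hc⟩ := hcoef i
    rw [← hc, algebraMap_smul]
    refine Submodule.smul_mem _ c (Submodule.subset_span ⟨⟨i, Finset.mem_range.1 hi⟩, ?_⟩)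
    rw [quotPowerBasis_apply]
    rfl

omit [Field F] [Algebra F E] in
/-- The vectors of the direct-sum basis built from the power bases. [folklore] -/
theorem dfinsuppBasis_quotPowerBasis_apply {d : ℕ} (g : Fin d → E[X]) (hg : ∀ i, (g i).Monic)
    (i : Fin d) (t : Fin (g i).natDegree) :
    (DFinsupp.basis fun i => quotPowerBasis (hg i) :
      Basis (Σ i : Fin d, Fin (g i).natDegree) E (⨁ i : Fin d, E[X] ⧸ E[X] ∙ g i)) ⟨i, t⟩ =
      DirectSum.of (fun j => E[X] ⧸ E[X] ∙ g j) i (quotPowerBasis (hg i) t) := by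
  classical
  rw [Basis.apply_eq_iff]
  simp only [DFinsupp.basis, DirectSum.of, LinearEquiv.trans_apply,
    DFinsupp.mapRange.linearEquiv_apply, LinearEquiv.symm_apply_eq,
    sigmaFinsuppLequivDFinsupp_apply]
  change _ = sigmaFinsuppEquivDFinsupp
    (Finsupp.single (⟨i, t⟩ : Σ i : Fin d, Fin (g i).natDegree) 1)
  rw [sigmaFinsuppEquivDFinsupp_single]
  change DFinsupp.mapRange (fun i x => (quotPowerBasis (hg i)).repr x) _
    (DFinsupp.single i (quotPowerBasis (hg i) t)) = _
  rw [DFinsupp.mapRange_single, Basis.repr_self]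

/-- **Direct sums of companion matrices are rational**: multiplication by `X` on
`⊕ᵢ E[X]/(gᵢ)`, `gᵢ ∈ E[X]` monic with coefficients in `F`, is rational over `F`. [folklore] -/
theorem isRationalEnd_X_smul_directSum {d : ℕ} (g : Fin d → E[X]) (hg : ∀ i, (g i).Monic)
    (hcoef : ∀ i n, (g i).coeff n ∈ Set.range (algebraMap F E)) :
    IsRationalEnd (W := ⨁ i : Fin d, E[X] ⧸ E[X] ∙ g i) F
      ((LinearMap.lsmul E[X] (⨁ i : Fin d, E[X] ⧸ E[X] ∙ g i) X).restrictScalars E) := by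
  classical
  set B : Basis (Σ i : Fin d, Fin (g i).natDegree) E (⨁ i : Fin d, E[X] ⧸ E[X] ∙ g i) :=
    DFinsupp.basis fun i => quotPowerBasis (hg i) with hB
  have hBapp : ∀ (i : Fin d) (t : Fin (g i).natDegree),
      B ⟨i, t⟩ = DirectSum.of (fun j => E[X] ⧸ E[X] ∙ g j) i (quotPowerBasis (hg i) t) :=
    fun i t => dfinsuppBasis_quotPowerBasis_apply g hg i t
  have hXof : ∀ (i : Fin d) (x : E[X] ⧸ E[X] ∙ g i),
      (X : E[X]) • DirectSum.of (fun j => E[X] ⧸ E[X] ∙ g j) i x =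
        DirectSum.of (fun j => E[X] ⧸ E[X] ∙ g j) i ((X : E[X]) • x) := fun i x => by
    rw [← DirectSum.lof_eq_of E[X], ← DirectSum.lof_eq_of E[X], map_smul]
  refine IsRationalEnd.of_basis B ?_
  rintro ⟨i, t⟩
  rw [LinearMap.restrictScalars_apply, LinearMap.lsmul_apply, hBapp, hXof]
  -- push the membership through the `F`-linear map `lof i`
  have hmem := X_smul_quotPowerBasis_mem_span (F := F) (hg i) (hcoef i) t
  have h1 := Submodule.apply_mem_span_image_of_mem_span
    ((DirectSum.lof E (Fin d) (fun j => E[X] ⧸ E[X] ∙ g j) i).restrictScalars F) hmem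
  rw [LinearMap.restrictScalars_apply, DirectSum.lof_eq_of] at h1
  refine Submodule.span_mono ?_ h1
  rintro _ ⟨_, ⟨t', rfl⟩, rfl⟩
  exact ⟨⟨i, t'⟩, by rw [hBapp, LinearMap.restrictScalars_apply, DirectSum.lof_eq_of]⟩

/-- **The block `q^σ = q`.** An endomorphism `T` of a finite-dimensional `E`-space killed by a
power of an irreducible monic `q ∈ E[X]` with coefficients in `F` is rational over `F`: by the
structure theorem (existence), `(V, T) ≅ ⊕ᵢ E[X]/(q^{kᵢ})` with `T ↦ X`, a direct sum of
companion matrices of polynomials over `F`. [folklore] -/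
theorem isRationalEnd_of_aeval_pow_eq_zero {V : Type*} [AddCommGroup V] [Module E V]
    [FiniteDimensional E V] [Module F V] [IsScalarTower F E V] (T : V →ₗ[E] V)
    {q : E[X]} (hq : Irreducible q) (hqm : q.Monic)
    (hcoef : ∀ n, q.coeff n ∈ Set.range (algebraMap F E)) {k : ℕ}
    (hT : aeval T (q ^ k) = 0) : IsRationalEnd F T := by
  classical
  -- `V` as an `E[X]`-module through `T` is `q^∞`-torsion
  have hA : Module.IsTorsion' (AEval' T) (Submonoid.powers q) := by
    intro a
    refine ⟨⟨q ^ k, k, rfl⟩, ?_⟩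
    obtain ⟨v, rfl⟩ := (AEval'.of T).surjective a
    change (q ^ k) • AEval'.of T v = 0
    rw [← AEval.of_aeval_smul]
    change AEval'.of T ((aeval T (q ^ k)) v) = 0
    rw [hT, LinearMap.zero_apply, map_zero]
  obtain ⟨d, kk, ⟨e⟩⟩ := Module.torsion_by_prime_power_decomposition hq hA
  -- the model: `X` acting on `⊕ᵢ E[X]/(q^{kᵢ})`
  set D := ⨁ i : Fin d, E[X] ⧸ E[X] ∙ q ^ kk i
  set Xm : D →ₗ[E] D := (LinearMap.lsmul E[X] D X).restrictScalars E with hXm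
  have hrat : IsRationalEnd (W := D) F Xm := by
    refine isRationalEnd_X_smul_directSum (F := F) (fun i => q ^ kk i) (fun i => hqm.pow _)
      fun i n => ?_
    have hl : q ^ kk i ∈ Polynomial.lifts (algebraMap F E) :=
      pow_mem ((Polynomial.lifts_iff_coeff_lifts q).2 hcoef) _
    exact (Polynomial.lifts_iff_coeff_lifts _).1 hl n
  -- transport along `V ≃ AEval' T ≃ D`
  set eV : V ≃ₗ[E] D := (AEval'.of T).trans (e.restrictScalars E) with heV
  have hinter : ∀ v, eV (T v) = Xm (eV v) := fun v => by
    simp only [heV, LinearEquiv.trans_apply, LinearEquiv.restrictScalars_apply, hXm,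
      LinearMap.restrictScalars_apply, LinearMap.lsmul_apply]
    rw [← AEval'.X_smul_of, map_smul]
  refine IsRationalEnd.of_equiv eV.symm (fun w => ?_) hrat
  apply eV.injective
  rw [LinearEquiv.apply_symm_apply, hinter, LinearEquiv.apply_symm_apply]

end FixedBlock

/-! ### The block `q^σ ≠ q`: free `σ`-orbits and the Moore matrix -/

section FreeBlock

/-- **Dedekind–Artin**: if the automorphisms `σ^j` (`j < ℓ`) are pairwise distinct and
`ε₁, …, ε_ℓ` is an `F`-basis of `E`, the (Moore) matrix `(σ^j(ε_k))_{j,k}` is invertible —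
a row relation `∑ⱼ cⱼ σ^j(ε_k) = 0` for all `k` extends `F`-linearly to `∑ⱼ cⱼ σ^j = 0`,
contradicting the linear independence of distinct characters. [folklore] -/
theorem det_moore_ne_zero {ℓ : ℕ} (σ : E ≃ₐ[F] E) (ε : Basis (Fin ℓ) F E)
    (hdist : Function.Injective fun j : Fin ℓ => (σ ^ (j : ℕ) : E ≃ₐ[F] E)) :
    (Matrix.of fun j k : Fin ℓ => (σ ^ (j : ℕ)) (ε k)).det ≠ 0 := by
  intro hdet
  obtain ⟨c, hc0, hc⟩ := Matrix.exists_vecMul_eq_zero_iff.2 hdet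
  -- the row relation, extended to all of `E`
  have hrel : ∀ e : E, ∑ j : Fin ℓ, c j * (σ ^ (j : ℕ)) e = 0 := by
    intro e
    have hk : ∀ k : Fin ℓ, ∑ j : Fin ℓ, c j * (σ ^ (j : ℕ)) (ε k) = 0 := fun k => by
      have := congrFun hc k
      simpa [Matrix.vecMul, dotProduct] using this
    calc ∑ j : Fin ℓ, c j * (σ ^ (j : ℕ)) e
        = ∑ j : Fin ℓ, c j * (σ ^ (j : ℕ)) (∑ k, ε.repr e k • ε k) := by rw [ε.sum_repr]
      _ = ∑ k, ε.repr e k • ∑ j : Fin ℓ, c j * (σ ^ (j : ℕ)) (ε k) := by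
          simp only [map_sum, map_smul, Finset.mul_sum, Finset.smul_sum, mul_smul_comm]
          exact Finset.sum_comm
      _ = 0 := by simp only [hk, smul_zero, Finset.sum_const_zero]
  -- linear independence of the distinct characters `σ^j`
  have hli : LinearIndependent E fun j : Fin ℓ => ((σ ^ (j : ℕ) : E ≃ₐ[F] E) : E → E) := by
    have h := (linearIndependent_monoidHom E E).comp
      (fun j : Fin ℓ => ((σ ^ (j : ℕ) : E ≃ₐ[F] E) : E →* E)) fun i j hij => hdist (by
        apply AlgEquiv.ext
        intro e
        exact DFunLike.congr_fun hij e)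
    exact h
  have hc : c = 0 := by
    funext j
    refine Fintype.linearIndependent_iff.1 hli c ?_ j
    funext e
    simpa [Finset.sum_apply, Pi.smul_apply, smul_eq_mul] using hrel e
  exact hc0 hc

/-- `∑_a ∑_b ∑_c = ∑_c ∑_b ∑_a`. [folklore] -/
private theorem sum_comm₃ {α β γ N : Type*} [Fintype α] [Fintype β] [Fintype γ]
    [AddCommMonoid N] (f : α → β → γ → N) :
    ∑ a, ∑ b, ∑ c, f a b c = ∑ c, ∑ b, ∑ a, f a b c := by
  rw [Finset.sum_comm]
  refine (Finset.sum_congr rfl fun b _ => Finset.sum_comm).trans ?_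
  rw [Finset.sum_comm]

variable {W : Type*} [AddCommGroup W] [Module E W] [FiniteDimensional E W]
  [Module F W] [IsScalarTower F E W]

/-- **The block `q^σ ≠ q`.** Let `φ` be a bijective `σ`-semilinear map of a finite-dimensional
`E`-space `W` commuting with `T`, with `φ^ℓ = T` and `σ^ℓ = 1`, the `σ^j` (`j < ℓ`) pairwise
distinct and `[E : F] = ℓ` (an `F`-basis `ε` of `E` indexed by `Fin ℓ`). If the conjugates
`qⱼ = q^{σ^j}` (`j < ℓ`) of `q ∈ E[X]` are pairwise coprime, then `ker (∏ⱼ qⱼ)^k(T)` is spanned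
by a finite linearly independent set with `T`-stable `F`-span: with `Mⱼ = ker qⱼ^k(T) = φ^j(M₀)`
and `b` a basis of `M₀`, the vectors `β'_{k,i} = ∑ⱼ σ^j(ε_k) φ^j(bᵢ)`. [folklore] -/
theorem exists_span_eq_ker_prod_conj {σ : E ≃ₐ[F] E} {ℓ : ℕ} (hσℓ : σ ^ ℓ = 1)
    (ε : Basis (Fin ℓ) F E)
    (hdist : Function.Injective fun j : Fin ℓ => (σ ^ (j : ℕ) : E ≃ₐ[F] E))
    {T : W →ₗ[E] W} {φ : W →ₛₗ[(σ : E →+* E)] W} (hφ : Function.Bijective φ)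
    (hφT : ∀ w, φ (T w) = T (φ w)) (hφℓ : ∀ w, (⇑φ)^[ℓ] w = T w) (q : E[X]) (k : ℕ)
    (hcop : Pairwise fun i j : Fin ℓ =>
      IsCoprime (q.map ((σ ^ (i : ℕ) : E ≃ₐ[F] E) : E →+* E))
        (q.map ((σ ^ (j : ℕ) : E ≃ₐ[F] E) : E →+* E))) :
    ∃ S : Set W, S.Finite ∧ LinearIndepOn E id S ∧
      Submodule.span E S = LinearMap.ker
        (aeval T ((∏ j : Fin ℓ, q.map ((σ ^ (j : ℕ) : E ≃ₐ[F] E) : E →+* E)) ^ k)) ∧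
      ∀ s ∈ S, T s ∈ Submodule.span F S := by
  classical
  -- the conjugates `qj a = q^{σ^a}` (indexed by `ℕ`), periodic of period `ℓ`
  set qj : ℕ → E[X] := fun a => q.map ((σ ^ a : E ≃ₐ[F] E) : E →+* E) with hqj
  have hqj_map : ∀ a c, (qj a).map ((σ ^ c : E ≃ₐ[F] E) : E →+* E) = qj (c + a) := by
    intro a c
    simp only [hqj, Polynomial.map_map]
    congr 1
    ext e
    simp [pow_add, AlgEquiv.mul_apply]
  have hqj_ℓ : qj ℓ = qj 0 := by simp only [hqj, hσℓ, pow_zero]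
  -- `T` is injective (`T = φ^ℓ`)
  have hTinj : Function.Injective T := by
    have : (⇑T) = (⇑φ)^[ℓ] := funext fun w => (hφℓ w).symm
    rw [this]
    exact hφ.1.iterate ℓ
  -- the submodules `M j = ker qⱼ^k(T)` and `M₀`
  set M : Fin ℓ → Submodule E W := fun j => LinearMap.ker (aeval T (qj j ^ k)) with hM
  set M₀ : Submodule E W := LinearMap.ker (aeval T (qj 0 ^ k)) with hM₀
  have hcopk : Pairwise fun i j : Fin ℓ => IsCoprime (qj i ^ k) (qj j ^ k) :=
    fun i j hij => (hcop hij).pow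
  have hind : iSupIndep M := iSupIndep_ker_aeval_of_pairwise_isCoprime (T := T) _ hcopk
  have hsup : ⨆ j, M j = LinearMap.ker (aeval T ((∏ j : Fin ℓ, qj j) ^ k)) := by
    rw [← Finset.prod_pow]
    exact iSup_ker_aeval_eq_of_pairwise_isCoprime _ hcopk
  -- a basis `b` of `M₀` and the family `β (j, i) = φ^j (b i) ∈ M j`
  set m := Module.finrank E M₀
  set b : Basis (Fin m) E M₀ := Module.finBasis E M₀
  set β : Fin ℓ × Fin m → W := fun p => (⇑φ)^[(p.1 : ℕ)] (b p.2 : W) with hβ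
  have hβmem : ∀ (j : Fin ℓ) (i : Fin m), β (j, i) ∈ M j := by
    intro j i
    have h := semilinear_iterate_mem_ker hφT (b i).2 (j : ℕ)
    rwa [Polynomial.map_pow, hqj_map, add_zero] at h
  -- the slices `i ↦ β (j, i)` are linearly independent
  have hbW : LinearIndependent E fun i : Fin m => (b i : W) :=
    b.linearIndependent.map' M₀.subtype M₀.ker_subtype
  have hslice : ∀ j : Fin ℓ, LinearIndependent E fun i : Fin m => β (j, i) := fun j =>
    linearIndependent_comp_semilinear (iterateSL φ j) (hφ.1.iterate _) hbW
  -- `β` is linearly independent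
  have hβli : LinearIndependent E β := by
    have h := linearIndependent_iUnion_finite (f := fun (j : Fin ℓ) (i : Fin m) => β (j, i))
      hslice fun j t _ hjt => by
        refine (iSupIndep_def.1 hind j).mono ?_ ?_
        · exact Submodule.span_le.2 (Set.range_subset_iff.2 fun i => hβmem j i)
        · refine iSup₂_le fun i hi => ?_
          have hij : i ≠ j := fun h => hjt (h ▸ hi)
          exact (Submodule.span_le.2 (Set.range_subset_iff.2 fun i' => hβmem i i')).trans
            (le_iSup₂_of_le i hij le_rfl)
    exact h.comp (Equiv.sigmaEquivProd (Fin ℓ) (Fin m)).symm (Equiv.injective _)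
  -- `span β = ⊕ⱼ M j`: `M j = φ^j (M₀)`
  have hspanβ : Submodule.span E (Set.range β) = ⨆ j, M j := by
    apply le_antisymm
    · rw [Submodule.span_le]
      rintro _ ⟨⟨j, i⟩, rfl⟩
      exact (le_iSup M j) (hβmem j i)
    · refine iSup_le fun j => fun w hw => ?_
      obtain ⟨v, rfl⟩ := (hφ.2.iterate (j : ℕ)) w
      have hv : v ∈ M₀ := by
        have h1 := semilinear_iterate_mem_ker hφT hw (ℓ - (j : ℕ))
        rw [Polynomial.map_pow, hqj_map, Nat.sub_add_cancel (le_of_lt j.2), hqj_ℓ,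
          ← Function.iterate_add_apply, Nat.sub_add_cancel (le_of_lt j.2), hφℓ] at h1
        rw [hM₀, LinearMap.mem_ker]
        rw [LinearMap.mem_ker, aeval_apply_comm] at h1
        apply hTinj
        rw [h1, map_zero]
      have hvsum : v = ∑ i, (b.repr ⟨v, hv⟩ i) • (b i : W) := by
        have h := congrArg (M₀.subtype : M₀ →ₗ[E] W) (b.sum_repr ⟨v, hv⟩)
        rw [map_sum] at h
        simp only [map_smul, Submodule.subtype_apply] at h
        exact h.symm
      rw [hvsum, show (⇑φ)^[(j : ℕ)] = ⇑(iterateSL φ j) from rfl, map_sum]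
      refine Submodule.sum_mem _ fun i _ => ?_
      rw [LinearMap.map_smulₛₗ]
      exact Submodule.smul_mem _ _ (Submodule.subset_span ⟨(j, i), rfl⟩)
  -- the Moore matrix and the twisted family `β'`
  set Δ : Matrix (Fin ℓ) (Fin ℓ) E := Matrix.of fun j kk : Fin ℓ => (σ ^ (j : ℕ)) (ε kk)
    with hΔ
  have hΔdet : Δ.det ≠ 0 := det_moore_ne_zero σ ε hdist
  set β' : Fin ℓ × Fin m → W := fun p => ∑ j, Δ j p.1 • β (j, p.2) with hβ'
  -- `β'` is linearly independent
  have hβ'li : LinearIndependent E β' := by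
    rw [Fintype.linearIndependent_iff]
    intro c hc
    have hexp : ∑ p, c p • β' p =
        ∑ r : Fin ℓ × Fin m, Δ.mulVec (fun kk => c (kk, r.2)) r.1 • β r := by
      simp only [hβ', Finset.smul_sum, smul_smul, Matrix.mulVec_apply_eq_sum, Finset.sum_smul]
      rw [Fintype.sum_prod_type, Fintype.sum_prod_type]
      rw [sum_comm₃]
      refine Finset.sum_congr rfl fun j _ => Finset.sum_congr rfl fun i _ =>
        Finset.sum_congr rfl fun kk _ => ?_
      rw [mul_comm]
    rw [hexp] at hc
    have hzero := Fintype.linearIndependent_iff.1 hβli _ hc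
    -- each column `kk ↦ c (kk, i)` is killed by `Δ`, hence vanishes
    have hcol : ∀ i : Fin m, (fun kk => c (kk, i)) = 0 := by
      intro i
      by_contra hne
      exact hΔdet (Matrix.exists_mulVec_eq_zero_iff.1 ⟨_, hne, funext fun j => hzero (j, i)⟩)
    rintro ⟨kk, i⟩
    exact congrFun (hcol i) kk
  -- `span β' = span β`
  have hspanβ' : Submodule.span E (Set.range β') = Submodule.span E (Set.range β) := by
    apply Submodule.eq_of_le_of_finrank_eq
    · rw [Submodule.span_le]
      rintro _ ⟨p, rfl⟩
      exact Submodule.sum_mem _ fun j _ =>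
        Submodule.smul_mem _ _ (Submodule.subset_span ⟨(j, p.2), rfl⟩)
    · rw [finrank_span_eq_card hβ'li, finrank_span_eq_card hβli]
  -- the matrix `U` of `T` on `M₀` in the basis `b`, and its `F`-coordinates `Y`
  have hTM₀ : ∀ v ∈ M₀, T v ∈ M₀ := fun v hv => mem_ker_aeval_of_mem _ hv
  set U : Fin m → Fin m → E := fun i' i => b.repr ⟨T (b i), hTM₀ _ (b i).2⟩ i' with hU
  have hTb : ∀ i, T (b i : W) = ∑ i', U i' i • (b i' : W) := by
    intro i
    have h := congrArg (M₀.subtype : M₀ →ₗ[E] W) (b.sum_repr ⟨T (b i), hTM₀ _ (b i).2⟩)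
    rw [map_sum] at h
    simp only [map_smul, Submodule.subtype_apply] at h
    exact h.symm
  set Y : Fin ℓ × Fin m → Fin ℓ × Fin m → F := fun r p => ε.repr (ε p.1 * U r.2 p.2) r.1
    with hY
  have hεU : ∀ (kk : Fin ℓ) (i' i : Fin m),
      ε kk * U i' i = ∑ kk', algebraMap F E (Y (kk', i') (kk, i)) * ε kk' := by
    intro kk i' i
    conv_lhs => rw [← ε.sum_repr (ε kk * U i' i)]
    simp only [hY, Algebra.smul_def]
  -- the key computation: `T β'_{kk,i} = ∑ Y • β'`
  have hTβ' : ∀ p, T (β' p) = ∑ r, algebraMap F E (Y r p) • β' r := by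
    rintro ⟨kk, i⟩
    have hL : T (β' (kk, i)) = ∑ j, ∑ i', ∑ kk',
        (algebraMap F E (Y (kk', i') (kk, i)) * Δ j kk') • β (j, i') := by
      simp only [hβ', map_sum, map_smul]
      refine Finset.sum_congr rfl fun j _ => ?_
      rw [hβ]
      dsimp only
      rw [← semilinear_iterate_comm hφT, hTb, show (⇑φ)^[(j : ℕ)] = ⇑(iterateSL φ j) from rfl,
        map_sum, Finset.smul_sum]
      refine Finset.sum_congr rfl fun i' _ => ?_
      rw [LinearMap.map_smulₛₗ, smul_smul, ← Finset.sum_smul]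
      congr 1
      have hΔj : ∀ kk', Δ j kk' = (σ ^ (j : ℕ)) (ε kk') := fun _ => rfl
      rw [hΔj, RingHom.coe_coe, ← map_mul, hεU, map_sum]
      refine Finset.sum_congr rfl fun kk' _ => ?_
      rw [map_mul, AlgEquiv.commutes, hΔj]
    have hR : ∑ r, algebraMap F E (Y r (kk, i)) • β' r = ∑ kk', ∑ i', ∑ j,
        (algebraMap F E (Y (kk', i') (kk, i)) * Δ j kk') • β (j, i') := by
      rw [Fintype.sum_prod_type]
      simp only [hβ', Finset.smul_sum, smul_smul]
    rw [hL, hR, sum_comm₃]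
  -- conclusion
  refine ⟨Set.range β', Set.finite_range _, hβ'li.linearIndepOn_id, ?_, ?_⟩
  · rw [hspanβ', hspanβ, hsup]
  · rintro _ ⟨p, rfl⟩
    rw [hTβ']
    refine Submodule.sum_mem _ fun r _ => ?_
    rw [algebraMap_smul]
    exact Submodule.smul_mem _ _ (Submodule.subset_span ⟨r, rfl⟩)

end FreeBlock

/-! ### The descent theorem -/

section Descent

variable {W : Type*} [AddCommGroup W] [Module E W]

omit [Field F] [Algebra F E] in
/-- Powers of a restriction are the restriction of the powers (on elements). [folklore] -/
theorem coe_restrict_pow_apply {T : W →ₗ[E] W} {V : Submodule E W} (hV : ∀ v ∈ V, T v ∈ V)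
    (n : ℕ) (v : V) : ((T.restrict hV ^ n) v : W) = (T ^ n) (v : W) := by
  induction n generalizing v with
  | zero => rfl
  | succ n ih => rw [pow_succ, Module.End.mul_apply, ih, pow_succ, Module.End.mul_apply]; rfl

omit [Field F] [Algebra F E] in
/-- `g(T|_V) = g(T)|_V` (on elements). [folklore] -/
theorem coe_aeval_restrict_apply {T : W →ₗ[E] W} {V : Submodule E W} (hV : ∀ v ∈ V, T v ∈ V)
    (g : E[X]) (v : V) : ((aeval (T.restrict hV) g) v : W) = aeval T g v := by
  induction g using Polynomial.induction_on' with
  | add p r hp hr => simp [hp, hr]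
  | monomial n c =>
    simp only [aeval_monomial, Module.End.mul_apply, Module.algebraMap_end_apply,
      Submodule.coe_smul, coe_restrict_pow_apply]

/-- **The orbit of `q` under `σ` is free when `q^σ ≠ q` and `σ^ℓ = 1` with `ℓ` prime**: the
conjugates `q^{σ^j}`, `j < ℓ`, are pairwise distinct. [folklore] -/
theorem map_pow_injective_of_prime {σ : E ≃ₐ[F] E} {ℓ : ℕ} (hℓ : ℓ.Prime) (hσℓ : σ ^ ℓ = 1)
    {q : E[X]} (hq : q.map (σ : E →+* E) ≠ q) :
    Function.Injective fun j : Fin ℓ => q.map ((σ ^ (j : ℕ) : E ≃ₐ[F] E) : E →+* E) := by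
  -- `f c = q^{σ^c}`: `f (c + c') = (f c')^{σ^c}`, `f ℓ = f 0 = q`
  set f : ℕ → E[X] := fun a => q.map ((σ ^ a : E ≃ₐ[F] E) : E →+* E) with hf
  have hf_map : ∀ a c, (f a).map ((σ ^ c : E ≃ₐ[F] E) : E →+* E) = f (c + a) := by
    intro a c
    simp only [hf, Polynomial.map_map]
    congr 1
    ext e
    simp [pow_add, AlgEquiv.mul_apply]
  have hf0 : f 0 = q := by
    simp only [hf, pow_zero]
    ext n
    simp [Polynomial.coeff_map]
  have hf1 : f 1 = q.map (σ : E →+* E) := by simp only [hf, pow_one]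
  have hfℓ : ∀ a, f (a + ℓ) = f a := fun a => by simp only [hf, pow_add, hσℓ, mul_one]
  have hfmod : ∀ a, f a = f (a % ℓ) := by
    intro a
    conv_lhs => rw [← Nat.mod_add_div a ℓ]
    induction a / ℓ with
    | zero => simp
    | succ n ih => rw [Nat.mul_succ, ← add_assoc, hfℓ, ih]
  -- if `f t = q` then `f (t * x) = q`
  have hfix_mul : ∀ t, f t = q → ∀ x, f (t * x) = q := by
    intro t ht x
    induction x with
    | zero => simpa using hf0
    | succ x ih =>
      rw [Nat.mul_succ, ← hf_map, ht]
      conv_lhs => rw [← hf0, hf_map, add_zero]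
      exact ih
  -- main argument
  have key : ∀ i j : Fin ℓ, (i : ℕ) < j → f i = f j → False := by
    intro i j hij hfij
    set t := (j : ℕ) - i with ht
    have ht0 : 0 < t := Nat.sub_pos_of_lt hij
    have htℓ : t < ℓ := lt_of_le_of_lt (Nat.sub_le _ _) j.2
    have hft : f t = q := by
      have h1 := congrArg (Polynomial.map ((σ ^ (ℓ - (i : ℕ)) : E ≃ₐ[F] E) : E →+* E)) hfij
      simp only [hf_map, Nat.sub_add_cancel (le_of_lt i.2)] at h1
      rw [show ℓ - (i : ℕ) + j = t + ℓ by omega, hfℓ, ← zero_add ℓ, hfℓ, hf0] at h1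
      exact h1.symm
    have hcop : Nat.Coprime t ℓ :=
      (Nat.coprime_comm).1 ((Nat.Prime.coprime_iff_not_dvd hℓ).2 (Nat.not_dvd_of_pos_of_lt ht0 htℓ))
    obtain ⟨x, -, hx⟩ := Nat.exists_mul_mod_eq_one_of_coprime hcop hℓ.one_lt
    have h2 := hfix_mul t hft x
    rw [hfmod, hx, hf1] at h2
    exact hq h2
  intro i j hfij
  rcases lt_trichotomy (i : ℕ) j with h | h | h
  · exact (key i j h hfij).elim
  · exact Fin.ext h
  · exact (key j i h hfij.symm).elim

variable [FiniteDimensional E W] [Module F W] [IsScalarTower F E W]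

/-- **Fitting step.** Let `φ` be a bijective `σ`-semilinear map commuting with `T` with
`φ^ℓ = T`, and `G ∈ E[X]` a `σ`-invariant polynomial with `ker G(T) ≠ 0`. By Fitting's lemma
`W = ker G(T)^k ⊕ im G(T)^k` for large `k`, both summands `T`- and `φ`-stable and the image of
smaller dimension; so `T` is rational over `F` as soon as its restriction to `ker G(T)^k` is and
the descent statement is known in smaller dimension (for `T`-stable subspaces of `W` carrying a
bijective `σ`-semilinear map with the same properties). [folklore] -/
theorem isRationalEnd_of_fitting {σ : E ≃ₐ[F] E} {ℓ : ℕ} {T : W →ₗ[E] W}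
    {φ : W →ₛₗ[(σ : E →+* E)] W} (hφ : Function.Bijective φ)
    (hφT : ∀ w, φ (T w) = T (φ w)) (hφℓ : ∀ w, (⇑φ)^[ℓ] w = T w)
    {G : E[X]} (hGσ : G.map (σ : E →+* E) = G) (hker : LinearMap.ker (aeval T G) ≠ ⊥)
    (h₁ : ∀ (k : ℕ) (h : ∀ v ∈ LinearMap.ker (aeval T (G ^ k)),
      T v ∈ LinearMap.ker (aeval T (G ^ k))), IsRationalEnd F (T.restrict h))
    (ih : ∀ (V : Submodule E W), finrank E V < finrank E W → ∀ (hV : ∀ v ∈ V, T v ∈ V)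
      (φV : V →ₛₗ[(σ : E →+* E)] V), Function.Bijective φV →
      (∀ v, φV (T.restrict hV v) = T.restrict hV (φV v)) →
      (∀ v, (⇑φV)^[ℓ] v = T.restrict hV v) → IsRationalEnd F (T.restrict hV)) :
    IsRationalEnd F T := by
  set S : Module.End E W := aeval T G with hS
  obtain ⟨k, hk, hk1⟩ :=
    ((LinearMap.eventually_isCompl_ker_pow_range_pow S).and (Filter.eventually_ge_atTop 1)).exists
  have hSk : S ^ k = aeval T (G ^ k) := by rw [hS, map_pow]
  rw [hSk] at hk
  set W₁ := LinearMap.ker (aeval T (G ^ k)) with hW₁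
  set W₂ := LinearMap.range (aeval T (G ^ k)) with hW₂
  have hGkσ : (G ^ k).map (σ : E →+* E) = G ^ k := by rw [Polynomial.map_pow, hGσ]
  -- stability
  have hT₁ : ∀ v ∈ W₁, T v ∈ W₁ := fun v hv => mem_ker_aeval_of_mem _ hv
  have hT₂ : ∀ v ∈ W₂, T v ∈ W₂ := fun v hv => mem_range_aeval_of_mem _ hv
  have hφ₁ : ∀ v ∈ W₁, φ v ∈ W₁ := fun v hv => by
    have h := semilinear_mem_ker hφT hv
    rwa [hGkσ] at h
  have hφ₂ : ∀ v ∈ W₂, φ v ∈ W₂ := fun v hv => by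
    have h := semilinear_mem_range hφT hv
    rwa [hGkσ] at h
  -- the restriction of `φ` to `W₂`
  set φ₂ : W₂ →ₛₗ[(σ : E →+* E)] W₂ := (φ.domRestrict W₂).codRestrict W₂ fun v => hφ₂ v.1 v.2
    with hφ₂def
  have hφ₂coe : ∀ v : W₂, (φ₂ v : W) = φ v := fun v => rfl
  have hφ₂it : ∀ (j : ℕ) (v : W₂), ((⇑φ₂)^[j] v : W) = (⇑φ)^[j] (v : W) := by
    intro j
    induction j with
    | zero => intro v; rfl
    | succ j ihj => intro v; rw [Function.iterate_succ_apply', Function.iterate_succ_apply',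
        hφ₂coe, ihj]
  have hφ₂bij : Function.Bijective φ₂ := by
    constructor
    · intro v w hvw
      apply Subtype.ext
      apply hφ.1
      rw [← hφ₂coe, ← hφ₂coe, hvw]
    · intro w
      obtain ⟨v, hv⟩ := hφ.2 (w : W)
      have hvmem : v ∈ W₁ ⊔ W₂ := by rw [hk.sup_eq_top]; exact Submodule.mem_top
      obtain ⟨v₁, hv₁, v₂, hv₂, rfl⟩ := Submodule.mem_sup.1 hvmem
      have h1 : φ v₁ ∈ W₁ ⊓ W₂ := by
        refine ⟨hφ₁ v₁ hv₁, ?_⟩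
        have : φ v₁ = w - φ v₂ := by rw [← hv, map_add]; abel
        rw [this]
        exact W₂.sub_mem w.2 (hφ₂ v₂ hv₂)
      rw [hk.inf_eq_bot, Submodule.mem_bot] at h1
      refine ⟨⟨v₂, hv₂⟩, Subtype.ext ?_⟩
      rw [hφ₂coe, ← hv, map_add, h1, zero_add]
  -- dimension drop
  have hlt : finrank E W₂ < finrank E W := by
    have hsum := Submodule.finrank_add_eq_of_isCompl hk
    have hne : finrank E W₁ ≠ 0 := by
      rw [Ne, Submodule.finrank_eq_zero]
      intro hbot
      apply hker
      rw [eq_bot_iff, ← hbot]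
      exact ker_aeval_le_of_dvd (dvd_pow_self G (by omega))
    omega
  -- assemble
  refine IsRationalEnd.of_isCompl hk hT₁ hT₂ (h₁ k hT₁) (ih W₂ hlt hT₂ φ₂ hφ₂bij ?_ ?_)
  · intro v
    apply Subtype.ext
    rw [hφ₂coe, LinearMap.coe_restrict_apply, LinearMap.coe_restrict_apply, hφ₂coe, hφT]
  · intro v
    apply Subtype.ext
    rw [hφ₂it, LinearMap.coe_restrict_apply, hφℓ]

/-- `(q^{σ^a})^{σ^c} = q^{σ^{c+a}}`. [folklore] -/
theorem map_pow_map_pow (σ : E ≃ₐ[F] E) (q : E[X]) (a c : ℕ) :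
    (q.map ((σ ^ a : E ≃ₐ[F] E) : E →+* E)).map ((σ ^ c : E ≃ₐ[F] E) : E →+* E) =
      q.map ((σ ^ (c + a) : E ≃ₐ[F] E) : E →+* E) := by
  rw [Polynomial.map_map]
  congr 1
  ext e
  simp [pow_add, AlgEquiv.mul_apply]

/-- `q^{σ^0} = q`. [folklore] -/
theorem map_pow_zero (σ : E ≃ₐ[F] E) (q : E[X]) :
    q.map ((σ ^ 0 : E ≃ₐ[F] E) : E →+* E) = q := by
  rw [pow_zero]
  ext n
  simp [Polynomial.coeff_map]

/-- The product `∏_{j<ℓ} q^{σ^j}` is `σ`-invariant when `σ^ℓ = 1`. [folklore] -/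
theorem map_prod_conj_eq {σ : E ≃ₐ[F] E} {ℓ : ℕ} (hσℓ : σ ^ ℓ = 1) {q : E[X]} (hq0 : q ≠ 0) :
    (∏ j : Fin ℓ, q.map ((σ ^ (j : ℕ) : E ≃ₐ[F] E) : E →+* E)).map (σ : E →+* E) =
      ∏ j : Fin ℓ, q.map ((σ ^ (j : ℕ) : E ≃ₐ[F] E) : E →+* E) := by
  set f : ℕ → E[X] := fun a => q.map ((σ ^ a : E ≃ₐ[F] E) : E →+* E) with hf
  have hfσ : ∀ a, (f a).map (σ : E →+* E) = f (a + 1) := fun a => by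
    have h := map_pow_map_pow σ q a 1
    rw [pow_one] at h
    rw [h, add_comm]
  have hfℓ : f ℓ = f 0 := by simp only [hf, hσℓ, pow_zero]
  have hf0 : f 0 ≠ 0 := by
    rw [hf]
    dsimp only
    rw [map_pow_zero]
    exact hq0
  change (∏ j : Fin ℓ, f j).map (σ : E →+* E) = ∏ j : Fin ℓ, f j
  rw [← Finset.prod_range f, Polynomial.map_prod]
  simp_rw [hfσ]
  have h1 := Finset.prod_range_succ' f ℓ
  have h2 := Finset.prod_range_succ f ℓ
  rw [hfℓ] at h2
  exact mul_right_cancel₀ hf0 (h1.symm.trans h2)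

universe u in
/-- **The descent theorem (core, by strong induction on the dimension).** See
`isRationalEnd_of_semilinear`. [folklore] -/
theorem isRationalEnd_of_semilinear_aux {σ : E ≃ₐ[F] E} {ℓ : ℕ} (hℓ : ℓ.Prime)
    (hσℓ : σ ^ ℓ = 1) (hfix : ∀ e : E, σ e = e → e ∈ Set.range (algebraMap F E))
    (ε : Basis (Fin ℓ) F E)
    (hdist : Function.Injective fun j : Fin ℓ => (σ ^ (j : ℕ) : E ≃ₐ[F] E)) (d : ℕ) :
    ∀ (V : Type u) [AddCommGroup V] [Module E V] [FiniteDimensional E V] [Module F V]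
      [IsScalarTower F E V], finrank E V = d →
      ∀ (T : V →ₗ[E] V) (φ : V →ₛₗ[(σ : E →+* E)] V), Function.Bijective φ →
        (∀ w, φ (T w) = T (φ w)) → (∀ w, (⇑φ)^[ℓ] w = T w) → IsRationalEnd F T := by
  induction d using Nat.strong_induction_on with
  | _ d ih =>
  intro V _ _ _ _ _ hd T φ hφ hφT hφℓ
  rcases subsingleton_or_nontrivial V with hV | hV
  · exact IsRationalEnd.of_subsingleton T
  -- the minimal polynomial of `T` and a monic irreducible factor `q`
  have hint : IsIntegral E T := IsIntegral.of_finite E T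
  set μ := minpoly E T with hμ
  have hμT : aeval T μ = 0 := minpoly.aeval E T
  have hμmonic : μ.Monic := minpoly.monic hint
  have hμu : ¬IsUnit μ := fun hu =>
    (minpoly.degree_pos hint).ne' (Polynomial.isUnit_iff_degree_eq_zero.1 hu)
  obtain ⟨q, hqm, hq, hqμ⟩ := Polynomial.exists_monic_irreducible_factor μ hμu
  -- `ker q(T) ≠ 0`, `q` dividing the minimal polynomial
  have hkerq : LinearMap.ker (aeval T q) ≠ ⊥ := by
    intro hbot
    obtain ⟨r, hr⟩ := hqμ
    have hrm : r.Monic := Monic.of_mul_monic_left hqm (hr ▸ hμmonic)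
    have hr0 : aeval T r = 0 := by
      ext w
      have h1 : aeval T q (aeval T r w) = 0 := by
        rw [← Module.End.mul_apply, ← map_mul, ← hr, hμT, LinearMap.zero_apply]
      have h2 : aeval T r w ∈ LinearMap.ker (aeval T q) := h1
      rw [hbot, Submodule.mem_bot] at h2
      rw [h2, LinearMap.zero_apply]
    have hdeg := Polynomial.natDegree_le_natDegree (minpoly.min E T hrm hr0)
    have hdeg2 : μ.natDegree = q.natDegree + r.natDegree := by
      rw [hr, hqm.natDegree_mul hrm]
    have hq1 : 0 < q.natDegree :=
      Polynomial.natDegree_pos_iff_degree_pos.2 (degree_pos_of_irreducible hq)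
    rw [← hμ] at hdeg
    omega
  -- the conjugates of `q` are irreducible
  have hirr : ∀ c : ℕ, Irreducible (q.map ((σ ^ c : E ≃ₐ[F] E) : E →+* E)) := fun c => by
    have : q.map ((σ ^ c : E ≃ₐ[F] E) : E →+* E) =
        Polynomial.mapEquiv ((σ ^ c : E ≃ₐ[F] E) : E ≃+* E) q := rfl
    rw [this]
    exact (MulEquiv.irreducible_iff _).2 hq
  -- the induction hypothesis in the form required by the Fitting step
  have ih' : ∀ (V₂ : Submodule E V), finrank E V₂ < finrank E V →
      ∀ (hV : ∀ v ∈ V₂, T v ∈ V₂) (φV : V₂ →ₛₗ[(σ : E →+* E)] V₂), Function.Bijective φV →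
      (∀ v, φV (T.restrict hV v) = T.restrict hV (φV v)) →
      (∀ v, (⇑φV)^[ℓ] v = T.restrict hV v) → IsRationalEnd F (T.restrict hV) :=
    fun V₂ hlt hV φV hφV hφVT hφVℓ => ih _ (hd ▸ hlt) V₂ rfl _ φV hφV hφVT hφVℓ
  by_cases hfixq : q.map (σ : E →+* E) = q
  · -- Case `q^σ = q`: `q ∈ F[X]`
    have hcoef : ∀ n, q.coeff n ∈ Set.range (algebraMap F E) := fun n => hfix _ (by
      have := congrArg (fun p => Polynomial.coeff p n) hfixq
      simpa [Polynomial.coeff_map] using this)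
    refine isRationalEnd_of_fitting hφ hφT hφℓ hfixq hkerq (fun k h => ?_) ih'
    refine isRationalEnd_of_aeval_pow_eq_zero (T.restrict h) hq hqm hcoef (k := k) ?_
    ext v
    rw [coe_aeval_restrict_apply]
    exact v.2
  · -- Case `q^σ ≠ q`: a free orbit
    have hinj := map_pow_injective_of_prime hℓ hσℓ hfixq
    have hcop : Pairwise fun i j : Fin ℓ =>
        IsCoprime (q.map ((σ ^ (i : ℕ) : E ≃ₐ[F] E) : E →+* E))
          (q.map ((σ ^ (j : ℕ) : E ≃ₐ[F] E) : E →+* E)) := fun i j hij =>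
      (Irreducible.coprime_iff_not_dvd (hirr i)).2 fun hdvd => hij (hinj
        (Polynomial.eq_of_monic_of_associated (hqm.map _) (hqm.map _)
          ((hirr i).associated_of_dvd (hirr j) hdvd)))
    set G := ∏ j : Fin ℓ, q.map ((σ ^ (j : ℕ) : E ≃ₐ[F] E) : E →+* E) with hG
    have hGσ : G.map (σ : E →+* E) = G := map_prod_conj_eq hσℓ hq.ne_zero
    have hqG : q ∣ G := by
      have h0 : q.map ((σ ^ ((⟨0, hℓ.pos⟩ : Fin ℓ) : ℕ) : E ≃ₐ[F] E) : E →+* E) = q :=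
        map_pow_zero σ q
      conv_lhs => rw [← h0]
      exact Finset.dvd_prod_of_mem _ (Finset.mem_univ _)
    have hkerG : LinearMap.ker (aeval T G) ≠ ⊥ := fun hbot => hkerq (by
      rw [eq_bot_iff, ← hbot]
      exact ker_aeval_le_of_dvd hqG)
    refine isRationalEnd_of_fitting hφ hφT hφℓ hGσ hkerG (fun k h => ?_) ih'
    obtain ⟨S, hSf, hSi, hSspan, hST⟩ :=
      exists_span_eq_ker_prod_conj hσℓ ε hdist hφ hφT hφℓ q k hcop
    exact IsRationalEnd.restrict_of_span_eq h S hSf hSi hSspan hST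

/-- **Descent of endomorphisms commuting with a `σ`-semilinear `ℓ`-th root** (`ℓ` prime).
Let `σ` be an automorphism of `E / F` with `σ^ℓ = 1`, fixed field `F` and `[E : F] = ℓ` (an
`F`-basis of `E` indexed by `Fin ℓ`), the `σ^j` (`j < ℓ`) pairwise distinct. If a bijective
`σ`-semilinear map `φ` of a finite-dimensional `E`-space commutes with `T` and `φ^ℓ = T`, then
`T` is rational over `F`. [folklore] -/
theorem isRationalEnd_of_semilinear {σ : E ≃ₐ[F] E} {ℓ : ℕ} (hℓ : ℓ.Prime) (hσℓ : σ ^ ℓ = 1)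
    (hfix : ∀ e : E, σ e = e → e ∈ Set.range (algebraMap F E)) (ε : Basis (Fin ℓ) F E)
    (hdist : Function.Injective fun j : Fin ℓ => (σ ^ (j : ℕ) : E ≃ₐ[F] E))
    (T : W →ₗ[E] W) (φ : W →ₛₗ[(σ : E →+* E)] W) (hφ : Function.Bijective φ)
    (hφT : ∀ w, φ (T w) = T (φ w)) (hφℓ : ∀ w, (⇑φ)^[ℓ] w = T w) : IsRationalEnd F T :=
  isRationalEnd_of_semilinear_aux hℓ hσℓ hfix ε hdist _ W rfl T φ hφ hφT hφℓ

end Descent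

/-! ### Arthur–Clozel, Lemma 1.1 (i): the norm is conjugate to a rational element -/

section NormMap

open scoped MatrixGroups

variable {n : Type*} [Fintype n] [DecidableEq n]

/-- **The `σ`-semilinear map `φ_x v = x · σ(v)` of `Eⁿ`** attached to `x ∈ GL_n(E)`: its `ℓ`-th
iterate is `v ↦ N x · σ^ℓ(v)`, i.e. multiplication by the norm `N x` when `σ^ℓ = 1`.
[folklore] -/
def twistFrob (σ : E ≃ₐ[F] E) (x : GL n E) : (n → E) →ₛₗ[(σ : E →+* E)] (n → E) where
  toFun v := (x : Matrix n n E).mulVec (⇑σ ∘ v)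
  map_add' v w := by
    have : (⇑σ ∘ (v + w)) = ⇑σ ∘ v + ⇑σ ∘ w := by
      funext i
      simp
    simp only [this, Matrix.mulVec_add]
  map_smul' c v := by
    have : (⇑σ ∘ (c • v)) = σ c • (⇑σ ∘ v) := by
      funext i
      simp [smul_eq_mul]
    simp only [this, Matrix.mulVec_smul, RingHom.coe_coe]

/-- `φ_x v = x · σ(v)` (definitional). [folklore] -/
@[simp]
theorem twistFrob_apply (σ : E ≃ₐ[F] E) (x : GL n E) (v : n → E) :
    twistFrob σ x v = (x : Matrix n n E).mulVec (⇑σ ∘ v) := rfl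

/-- **`φ_x^k (v) = N_k x · σ^k(v)`.** [folklore] -/
theorem twistFrob_iterate (σ : E ≃ₐ[F] E) (x : GL n E) (k : ℕ) (v : n → E) :
    (⇑(twistFrob σ x))^[k] v =
      ((normMap σ k x : GL n E) : Matrix n n E).mulVec (⇑(σ ^ k) ∘ v) := by
  induction k generalizing v with
  | zero =>
    simp only [Function.iterate_zero, id_eq, normMap_zero, Units.val_one, Matrix.one_mulVec,
      pow_zero]
    rfl
  | succ k ih =>
    rw [Function.iterate_succ_apply, ih, twistFrob_apply, normMap_succ, Units.val_mul,
      ← Matrix.mulVec_mulVec]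
    congr 1
    have hcoe : ((galAct (σ ^ k) x : GL n E) : Matrix n n E) =
        (x : Matrix n n E).map (σ ^ k) := by
      ext i j
      simp
    rw [hcoe]
    funext i
    have h := RingHom.map_mulVec ((σ ^ k : E ≃ₐ[F] E) : E →+* E) (x : Matrix n n E) (⇑σ ∘ v) i
    simp only [RingHom.coe_coe] at h
    rw [Function.comp_apply, h]
    congr 1

/-- `φ_x^ℓ = N x` when `σ^ℓ = 1`. [folklore] -/
theorem twistFrob_iterate_of_pow_eq_one {σ : E ≃ₐ[F] E} {ℓ : ℕ} (hσ : σ ^ ℓ = 1) (x : GL n E)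
    (v : n → E) :
    (⇑(twistFrob σ x))^[ℓ] v = ((normMap σ ℓ x : GL n E) : Matrix n n E).mulVec v := by
  rw [twistFrob_iterate, hσ]
  rfl

/-- `φ_x` commutes with multiplication by `N x` (`= φ_x^ℓ`) when `σ^ℓ = 1`. [folklore] -/
theorem twistFrob_mulVec_normMap {σ : E ≃ₐ[F] E} {ℓ : ℕ} (hσ : σ ^ ℓ = 1) (x : GL n E)
    (v : n → E) :
    twistFrob σ x (((normMap σ ℓ x : GL n E) : Matrix n n E).mulVec v) =
      ((normMap σ ℓ x : GL n E) : Matrix n n E).mulVec (twistFrob σ x v) := by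
  rw [← twistFrob_iterate_of_pow_eq_one hσ x v,
    ← twistFrob_iterate_of_pow_eq_one hσ x (twistFrob σ x v),
    ← Function.iterate_succ_apply' (f := ⇑(twistFrob σ x)), Function.iterate_succ_apply]

/-- `φ_x` is bijective, with inverse `w ↦ σ⁻¹(x⁻¹ w)`. [folklore] -/
theorem twistFrob_bijective (σ : E ≃ₐ[F] E) (x : GL n E) :
    Function.Bijective (twistFrob σ x) := by
  refine Function.bijective_iff_has_inverse.2
    ⟨fun w => ⇑σ.symm ∘ ((x⁻¹ : GL n E) : Matrix n n E).mulVec w, fun v => ?_, fun w => ?_⟩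
  · simp only [twistFrob_apply, Matrix.mulVec_mulVec, Units.inv_mul, Matrix.one_mulVec]
    funext i
    simp
  · simp only [twistFrob_apply]
    have : (⇑σ ∘ (⇑σ.symm ∘ ((x⁻¹ : GL n E) : Matrix n n E).mulVec w)) =
        ((x⁻¹ : GL n E) : Matrix n n E).mulVec w := by
      funext i
      simp
    rw [this, Matrix.mulVec_mulVec, Units.mul_inv, Matrix.one_mulVec]

/-- **Arthur–Clozel, Lemma 1.1 (i), existence — abstract hypotheses.** Let `σ` be an
automorphism of `E / F` of prime order `ℓ` (`σ^ℓ = 1`, the `σ^j`, `j < ℓ`, pairwise distinct)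
with fixed field `F` and `[E : F] = ℓ`. Then for every `x ∈ GL_n(E)` the norm
`N x = x x^σ ⋯ x^{σ^{ℓ-1}}` is conjugate in `GL_n(E)` to (the image of) an element of `GL_n(F)`.
[cite: ArthurClozelAMS120, Ch. 1, Lemma 1.1] -/
theorem exists_isConj_map_algebraMap_normMap_of {σ : E ≃ₐ[F] E} {ℓ : ℕ} (hℓ : ℓ.Prime)
    (hσℓ : σ ^ ℓ = 1) (hfix : ∀ e : E, σ e = e → e ∈ Set.range (algebraMap F E))
    (ε : Basis (Fin ℓ) F E)
    (hdist : Function.Injective fun j : Fin ℓ => (σ ^ (j : ℕ) : E ≃ₐ[F] E)) (x : GL n E) :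
    ∃ y : GL n F,
      IsConj (Matrix.GeneralLinearGroup.map (algebraMap F E) y) (normMap σ ℓ x) := by
  classical
  set u : GL n E := normMap σ ℓ x with hu
  set T : (n → E) →ₗ[E] (n → E) := Matrix.toLin' (u : Matrix n n E) with hT
  -- `u` is rational over `F`
  have hrat : IsRationalEnd F T :=
    isRationalEnd_of_semilinear hℓ hσℓ hfix ε hdist T (twistFrob σ x) (twistFrob_bijective σ x)
      (fun w => by
        rw [hT, Matrix.toLin'_apply, Matrix.toLin'_apply]
        exact twistFrob_mulVec_normMap hσℓ x w)
      (fun w => by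
        rw [hT, Matrix.toLin'_apply]
        exact twistFrob_iterate_of_pow_eq_one hσℓ x w)
  obtain ⟨S, hSf, hSi, hSs, hST⟩ := hrat
  -- a basis of `Eⁿ` inside `S`, indexed by `n`
  haveI : Fintype S := hSf.fintype
  have hrange : Set.range (fun s : S => (s : n → E)) = S := Subtype.range_coe
  set bS : Basis S E (n → E) := Basis.mk hSi (by
    change ⊤ ≤ Submodule.span E (Set.range fun s : S => (s : n → E))
    rw [hrange, hSs]) with hbS
  have hbSapp : ∀ s : S, bS s = (s : n → E) := fun s => by
    rw [hbS, Basis.mk_apply]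
    rfl
  have hcard : Fintype.card S = Fintype.card n := by
    rw [← Module.finrank_eq_card_basis bS, Module.finrank_fintype_fun_eq_card]
  set e : S ≃ n := Fintype.equivOfCardEq hcard
  set b : Basis n E (n → E) := bS.reindex e with hb
  have hbapp : ∀ j, b j = ((e.symm j : S) : n → E) := fun j => by
    rw [hb, Basis.reindex_apply, hbSapp]
  have hbrange : Set.range b = S := by
    rw [hb, Basis.range_reindex]
    rw [show (⇑bS : S → n → E) = fun s : S => (s : n → E) from funext hbSapp, hrange]
  -- the matrix of `T` in the basis `b` has entries in `F`
  have hentries : ∀ i j, LinearMap.toMatrix b b T i j ∈ Set.range (algebraMap F E) := by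
    intro i j
    rw [LinearMap.toMatrix_apply]
    have hmem : T (b j) ∈ Submodule.span F (Set.range b) := by
      rw [hbrange, hbapp]
      exact hST _ (e.symm j).2
    exact (b.mem_span_iff_repr_mem F (T (b j))).1 hmem i
  choose c hc using hentries
  set Y' : Matrix n n F := Matrix.of fun i j => c i j with hY'
  have hY : (Y'.map (algebraMap F E) : Matrix n n E) = LinearMap.toMatrix b b T := by
    ext i j
    simp [hY', hc]
  -- change of basis: `A Y A' = u`
  set A : Matrix n n E := (Pi.basisFun E n).toMatrix b with hA
  set A' : Matrix n n E := b.toMatrix (Pi.basisFun E n) with hA'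
  have hAA' : A * A' = 1 := Basis.toMatrix_mul_toMatrix_flip _ _
  have hA'A : A' * A = 1 := Basis.toMatrix_mul_toMatrix_flip _ _
  have hconj : A * LinearMap.toMatrix b b T * A' = (u : Matrix n n E) := by
    rw [hA, hA', basis_toMatrix_mul_linearMap_toMatrix_mul_basis_toMatrix,
      LinearMap.toMatrix_eq_toMatrix', hT, LinearMap.toMatrix'_toLin']
  -- `det Y' ≠ 0`
  have hdetY : Y'.det ≠ 0 := by
    intro h0
    have h1 : (LinearMap.toMatrix b b T).det = 0 := by
      rw [← hY, ← RingHom.mapMatrix_apply, ← RingHom.map_det, h0, map_zero]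
    have h2 : (u : Matrix n n E).det = 0 := by
      rw [← hconj, Matrix.det_mul, Matrix.det_mul, h1, mul_zero, zero_mul]
    exact (Matrix.isUnit_iff_isUnit_det (u : Matrix n n E) |>.1 u.isUnit).ne_zero h2
  -- conclusion
  set AU : GL n E := ⟨A, A', hAA', hA'A⟩ with hAU
  refine ⟨Matrix.GeneralLinearGroup.mkOfDetNeZero Y' hdetY, isConj_iff.2 ⟨AU, ?_⟩⟩
  apply Units.ext
  simp only [Units.val_mul, hu]
  rw [← hconj, ← hY]
  congr 1

/-- **Arthur–Clozel, Ch. 1, Lemma 1.1 (i), existence clause** (following Langlands, *Base change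
for `GL(2)`*, §4), for a Galois extension `E / F` of **prime** degree `ℓ` and `1 ≠ σ ∈ Gal(E/F)`
(so that `Gal(E/F) = ⟨σ⟩`): *for `x ∈ GL_n(E)`, the norm `N x = x x^σ x^{σ²} ⋯ x^{σ^{ℓ-1}}` is
conjugate in `GL_n(E)` to an element `y` of `GL_n(F)`* — `y` is unique up to `GL_n(F)`-conjugacy
by `isConj_of_isConj_map_algebraMap`, and `x ↦ (class of y)` is the norm map `𝒩` from
`σ`-conjugacy classes of `GL_n(E)` to conjugacy classes of `GL_n(F)` of Lemma 1.1 (ii). Printed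
for a cyclic extension of arbitrary degree `ℓ` (proved there through the `σ`-invariance of the
elementary divisors of `N x`); here `ℓ` is prime, the case of the base-change theorems of Ch. 3.
-- TODO(general form): cyclic `E / F` of composite degree (same statement; the present proof's
-- orbit dichotomy `q^σ = q` or free orbit must be replaced by an induction over the stabiliser).
[cite: ArthurClozelAMS120, Ch. 1, Lemma 1.1] -/
theorem exists_isConj_map_algebraMap_normMap [FiniteDimensional F E] [IsGalois F E]
    (hprime : (finrank F E).Prime) {σ : E ≃ₐ[F] E} (hσ : σ ≠ 1) (x : GL n E) :
    ∃ y : GL n F,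
      IsConj (Matrix.GeneralLinearGroup.map (algebraMap F E) y) (normMap σ (finrank F E) x) := by
  have hcard : Nat.card (E ≃ₐ[F] E) = finrank F E := IsGalois.card_aut_eq_finrank F E
  -- `σ` has order `ℓ = [E : F]`
  have hord : orderOf σ = finrank F E := by
    have hdvd : orderOf σ ∣ finrank F E := hcard ▸ orderOf_dvd_natCard σ
    rcases (Nat.dvd_prime hprime).1 hdvd with h1 | h1
    · exact absurd (orderOf_eq_one_iff.1 h1) hσ
    · exact h1
  have hσℓ : σ ^ finrank F E = 1 := hord ▸ pow_orderOf_eq_one σ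
  have hdist : Function.Injective fun j : Fin (finrank F E) => (σ ^ (j : ℕ) : E ≃ₐ[F] E) :=
    fun i j hij => Fin.ext (pow_injOn_Iio_orderOf (by rw [Set.mem_Iio, hord]; exact i.2)
      (by rw [Set.mem_Iio, hord]; exact j.2) hij)
  -- `⟨σ⟩ = Gal(E/F)`, so the fixed field of `σ` is `F`
  have htop : Subgroup.zpowers σ = ⊤ := by
    apply Subgroup.eq_top_of_card_eq
    rw [Nat.card_zpowers, hord, hcard]
  have hfix : ∀ e : E, σ e = e → e ∈ Set.range (algebraMap F E) := by
    intro e he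
    have hstab : Subgroup.zpowers σ ≤ MulAction.stabilizer (E ≃ₐ[F] E) e :=
      Subgroup.zpowers_le.2 (MulAction.mem_stabilizer_iff.2 he)
    have hmem : e ∈ IntermediateField.fixedField (⊤ : Subgroup (E ≃ₐ[F] E)) := by
      rw [IntermediateField.mem_fixedField_iff]
      intro τ _
      have hτ : τ ∈ Subgroup.zpowers σ := htop ▸ Subgroup.mem_top τ
      exact MulAction.mem_stabilizer_iff.1 (hstab hτ)
    rw [IsGalois.fixedField_top] at hmem
    exact IntermediateField.mem_bot.1 hmem
  exact exists_isConj_map_algebraMap_normMap_of hprime hσℓ hfix (Module.finBasis F E) hdist x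

end NormMap

end ArthurClozel

end Literature.NumberTheory.Automorphic
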